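import Summits.HodgeConjecture.CorCM.CMSixfoldRank.DefectNullSets
import HarnessLib

/-!
# Rank of CM types on twelve embeddings, II: the separating case has rank `≤ 3`

Second file of the proof that a primitive CM type on `12` embeddings has rank `≥ 6`
(`RankAtLeastSix.lean`).  If a non-zero `G`-stable space `M` of balanced `ρ`-anti-invariant weights
takes different values at different points of `E` (`|E| = 12`), then for each `g` the `M`-null set `Φ ∖ g⁻¹Φ` has
`0`, `3` or `6` elements and the null `3`-sets form at most one complementary pair, so every sign vector
`u_g = 2·𝟙_{g⁻¹Φ} − 1` is `±u_1` or `±u_{g₁}`: `rank(Φ) = dim span{u_g} + 1 ≤ 3`.  Everything PROVED; no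
definition, no named fact.

## References (held texts)

* B. Dodson, *On the Mumford–Tate group of an abelian variety with complex multiplication*, J. Algebra 111 (1987)
  [Dodson1987] (`paper:doi-10-1016-0021-8693-87-90242-0`), p0003 Thm. 1.0, Thm. 1.4; p0004 Cor. 1.5.
* T. Kubota, Trans. AMS 118 (1965) [Kubota1965], §4 (defect).  K. A. Ribet, Mém. SMF 2 (1980) [Ribet1980], §3 (3.5).
* B. B. Gordon, *A survey of the Hodge conjecture for abelian varieties* [Gordon1999HodgeAVSurvey], §9.2 (9.2.1), 9.4.
-/

noncomputable section

open scoped BigOperators Pointwise Classical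

namespace Summit.HodgeConjecture.CorCM.CMSixfoldRank

open Literature.NumberTheory.ComplexMultiplication
open Literature.NumberTheory.ComplexMultiplication.IsCMTypeWith

variable {G : Type*} [Group G] {E : Type*} [MulAction G E]

variable {ρ : G} {Φ : Set E} (h : IsCMTypeWith ρ Φ)
include h

/-- **Separating case: if the values of `M` separate the points of `E` then `rank(Φ) ≤ 3`** (`|E| = 12`, `M` a
non-zero `G`-stable space of balanced `ρ`-anti-invariant weights).  For each `g`, `Φ ∩ g⁻¹Φ` and `Φ ∖ g⁻¹Φ` are
`M`-null, so `|Φ ∖ g⁻¹Φ| ∈ {0, 3, 6}` and the null `3`-sets are one complementary pair at most: every sign vector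
`u_g` is `±u_1` or `±u_{g₁}`. [folklore] -/
theorem typeRank_le_three_of_separating [Fintype E] [MulAction.IsPretransitive G E]
    (M : Submodule ℚ (E → ℚ)) (hMa : ∀ μ ∈ M, ∀ x, μ (ρ • x) = -μ x) (hMb : ∀ μ ∈ M, IsBalanced G Φ μ)
    (hMG : ∀ μ ∈ M, ∀ g : G, (fun x => μ (g • x)) ∈ M) (hM : M ≠ ⊥) (hcard : Fintype.card E = 12)
    (hinj : ∀ x y : E, (∀ μ ∈ M, μ x = μ y) → x = y) : typeRank G Φ ≤ 3 := by
  haveI : Nonempty E := Fintype.card_pos_iff.1 (by omega)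
  have hcΦ : (Finset.univ.filter fun x : E => x ∈ Φ).card = 6 := by
    have h1 := card_filter_mem_mul_two h
    rw [hcard] at h1
    omega
  set Φf : Finset E := Finset.univ.filter fun x : E => x ∈ Φ with hΦf
  have hmemΦf : ∀ {x : E}, x ∈ Φf ↔ x ∈ Φ := fun {x} => by simp [hΦf]
  -- the null sets `Q g = Φ ∖ g⁻¹Φ`, `P g = Φ ∩ g⁻¹Φ`
  have hQnull : ∀ (g : G), ∀ μ ∈ M, ∑ x ∈ Φf.filter (fun x => g • x ∉ Φ), μ x = 0 :=
    fun g μ hμ => (sum_filter_filter_eq_zero h M hMa hMb g hμ).2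
  have hPnull : ∀ (g : G), ∀ μ ∈ M, ∑ x ∈ Φf.filter (fun x => g • x ∈ Φ), μ x = 0 :=
    fun g μ hμ => (sum_filter_filter_eq_zero h M hMa hMb g hμ).1
  have hPQ : ∀ g : G, (Φf.filter fun x => g • x ∈ Φ).card + (Φf.filter fun x => g • x ∉ Φ).card = 6 :=
    fun g => by rw [← hcΦ]; exact Finset.card_filter_add_card_filter_not _
  have hPeq : ∀ g : G, (Φf.filter fun x => g • x ∈ Φ) = Φf \ Φf.filter (fun x => g • x ∉ Φ) := fun g => by
    ext x; simp only [Finset.mem_filter, Finset.mem_sdiff]; tauto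
  have hQ036 : ∀ g : G, (Φf.filter fun x => g • x ∉ Φ).card = 0 ∨ (Φf.filter fun x => g • x ∉ Φ).card = 3 ∨
      (Φf.filter fun x => g • x ∉ Φ).card = 6 := by
    intro g
    have hQ1 : (Φf.filter fun x => g • x ∉ Φ).card ≠ 1 := fun h1 =>
      false_of_sum_singleton M hMG hM h1 (hQnull g)
    have hQ2 : (Φf.filter fun x => g • x ∉ Φ).card ≠ 2 := fun h2 =>
      false_of_card_eq_two h M hMa hinj (fun x hx => hmemΦf.1 (Finset.mem_filter.1 hx).1) h2 (hQnull g)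
    have hP1 : (Φf.filter fun x => g • x ∈ Φ).card ≠ 1 := fun h1 =>
      false_of_sum_singleton M hMG hM h1 (hPnull g)
    have hP2 : (Φf.filter fun x => g • x ∈ Φ).card ≠ 2 := fun h2 =>
      false_of_card_eq_two h M hMa hinj (fun x hx => hmemΦf.1 (Finset.mem_filter.1 hx).1) h2 (hPnull g)
    have h6 := hPQ g
    omega
  -- sign vectors: `|Q g| = 0` gives `u_g = u_1`, `|Q g| = 6` gives `u_g = -u_1`
  have hu0 : ∀ g : G, (Φf.filter fun x => g • x ∉ Φ).card = 0 → antiVec Φ g = antiVec Φ (1 : G) := by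
    intro g h0
    apply antiVec_eq_of_forall_iff
    refine forall_smul_mem_iff_of_forall_mem h fun x hx => ?_
    rw [one_smul]
    refine ⟨fun _ => hx, fun _ => ?_⟩
    by_contra hgx
    have hx' : x ∈ Φf.filter fun x => g • x ∉ Φ := Finset.mem_filter.2 ⟨hmemΦf.2 hx, hgx⟩
    rw [Finset.card_eq_zero.1 h0] at hx'
    exact Finset.notMem_empty x hx'
  have hu6 : ∀ g : G, (Φf.filter fun x => g • x ∉ Φ).card = 6 → antiVec Φ g = -antiVec Φ (1 : G) := by
    intro g h6
    apply antiVec_eq_neg_of_forall_iff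
    refine forall_smul_mem_iff_not_of_forall_mem h fun x hx => ?_
    rw [one_smul]
    have hQe : (Φf.filter fun x => g • x ∉ Φ) = Φf :=
      Finset.eq_of_subset_of_card_le (Finset.filter_subset _ _) (by omega)
    have hxQ : x ∈ Φf.filter fun x => g • x ∉ Φ := by rw [hQe]; exact hmemΦf.2 hx
    exact ⟨fun hgx => absurd hgx (Finset.mem_filter.1 hxQ).2, fun hnx => absurd hx hnx⟩
  -- equal `Q`'s give equal sign vectors, complementary `Q`'s opposite ones
  have huQ : ∀ g g' : G, (Φf.filter fun x => g • x ∉ Φ) = (Φf.filter fun x => g' • x ∉ Φ) →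
      antiVec Φ g = antiVec Φ g' := by
    intro g g' hQQ
    apply antiVec_eq_of_forall_iff
    refine forall_smul_mem_iff_of_forall_mem h fun x hx => ?_
    have h1 : (x ∈ Φf.filter fun x => g • x ∉ Φ) ↔ (x ∈ Φf.filter fun x => g' • x ∉ Φ) := by rw [hQQ]
    simp only [Finset.mem_filter, hmemΦf.2 hx, true_and] at h1
    exact not_iff_not.1 h1
  have huQ' : ∀ g g' : G, (Φf.filter fun x => g • x ∉ Φ) = Φf \ (Φf.filter fun x => g' • x ∉ Φ) →
      antiVec Φ g = -antiVec Φ g' := by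
    intro g g' hQQ
    apply antiVec_eq_neg_of_forall_iff
    refine forall_smul_mem_iff_not_of_forall_mem h fun x hx => ?_
    have h1 : (x ∈ Φf.filter fun x => g • x ∉ Φ) ↔ (x ∈ Φf \ Φf.filter fun x => g' • x ∉ Φ) := by rw [hQQ]
    simp only [Finset.mem_filter, Finset.mem_sdiff, hmemΦf.2 hx, true_and, not_not] at h1
    constructor
    · intro hgx hg'x; exact (h1.2 hg'x) hgx
    · intro hg'x; by_contra hgx; exact hg'x (h1.1 hgx)
  -- conclusion: `U ≤ span{u_1, u_{g₁}}`
  have hrank := h.typeRank_eq_finrank_antiSpan_add_one (G := G)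
  suffices hfin : Module.finrank ℚ (antiSpan G Φ) ≤ 2 by omega
  have key : ∃ w : E → ℚ, ∀ g : G, antiVec Φ g = antiVec Φ (1 : G) ∨ antiVec Φ g = -antiVec Φ (1 : G) ∨
      antiVec Φ g = w ∨ antiVec Φ g = -w := by
    by_cases hex : ∃ g₁ : G, (Φf.filter fun x => g₁ • x ∉ Φ).card = 3
    · obtain ⟨g₁, hg₁⟩ := hex
      refine ⟨antiVec Φ g₁, fun g => ?_⟩
      rcases hQ036 g with h0 | h3 | h6
      · exact Or.inl (hu0 g h0)
      · have hB' : ∀ μ ∈ M, ∑ x ∈ Φf \ Φf.filter (fun x => g₁ • x ∉ Φ), μ x = 0 := by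
          rw [← hPeq g₁]; exact hPnull g₁
        rcases eq_or_eq_sdiff_of_null M hinj (Finset.filter_subset _ _) (Finset.filter_subset _ _)
            (hQnull g) (hQnull g₁) hB' h3 hg₁ hcΦ with hQQ | hQQ
        · exact Or.inr (Or.inr (Or.inl (huQ g g₁ hQQ)))
        · exact Or.inr (Or.inr (Or.inr (huQ' g g₁ hQQ)))
      · exact Or.inr (Or.inl (hu6 g h6))
    · refine ⟨antiVec Φ (1 : G), fun g => ?_⟩
      rcases hQ036 g with h0 | h3 | h6
      · exact Or.inl (hu0 g h0)
      · exact (hex ⟨g, h3⟩).elim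
      · exact Or.inr (Or.inl (hu6 g h6))
  obtain ⟨w, hw⟩ := key
  set S : Finset (E → ℚ) := {antiVec Φ (1 : G), w} with hS
  have hle : antiSpan G Φ ≤ Submodule.span ℚ (↑S : Set (E → ℚ)) := by
    show Submodule.span ℚ (Set.range fun g : G => antiVec Φ g) ≤ _
    refine Submodule.span_le.2 ?_
    rintro _ ⟨g, rfl⟩
    have hu1 : antiVec Φ (1 : G) ∈ Submodule.span ℚ (↑S : Set (E → ℚ)) :=
      Submodule.subset_span (by simp [hS])
    have hwS : w ∈ Submodule.span ℚ (↑S : Set (E → ℚ)) := Submodule.subset_span (by simp [hS])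
    simp only [SetLike.mem_coe]
    rcases hw g with h1 | h1 | h1 | h1 <;> rw [h1]
    exacts [hu1, Submodule.neg_mem _ hu1, hwS, Submodule.neg_mem _ hwS]
  calc Module.finrank ℚ (antiSpan G Φ) ≤ Module.finrank ℚ (Submodule.span ℚ (↑S : Set (E → ℚ))) :=
        Submodule.finrank_mono hle
    _ ≤ S.card := finrank_span_finset_le_card S
    _ ≤ 2 := Finset.card_le_two

end Summit.HodgeConjecture.CorCM.CMSixfoldRank

end
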